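import Mathlib
import Literature.Probability.RandomMatrix.LovasAndaiDefectFunction

/-!
# Lovas–Andai Lemma 6, part I: the operator-norm unit ball of `ℝ^{2×2}` in coordinates

First of three files proving `LovasAndai2017_lemma6` (A. Lovas, A. Andai, *Invariance of
separability probability over reduced states in 4 × 4 bipartite systems*, J. Phys. A 50 (2017)
295303, Lemma 6 with proof in Appendix A; arXiv:1610.01410 [LovasAndai2017]).

This file supplies the coordinate description of the integrand of Lovas–Andai's `χ₁`
(Definition 1, spelled through their Lemma 3 as `1 − XᵀX ≻ 0` in
`LovasAndaiDefectFunction.lean`):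

* `posDef_fin_two_iff` — a real symmetric `2 × 2` matrix is positive definite iff its determinant
  and trace are positive;
* `posDef_one_sub_iff` — for `X = [[a, b], [c, d]]`,
  `1 − XᵀX ≻ 0 ⟺ N(a,b,c,d) := √((a+d)² + (b−c)²) + √((a−d)² + (b+c)²) < 2`
  (`N/2` is the largest singular value of `X`: writing `X = pI + qJ + rK + sL` in the basis
  `I, J = [[0,1],[-1,0]], K = diag(1,-1), L = [[0,1],[1,0]]` the singular values are
  `√(p²+q²) ± √(r²+s²)`);
* `volume_normBall` — the Lebesgue volume of `{N < 2} ⊆ ℝ⁴` is `2π²/3`, obtained from Mathlib's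
  `Complex.volume_sum_rpow_lt` (volume of `{‖z₁‖ + ‖z₂‖ < r} ⊆ ℂ²`) through the linear map
  `(a,b,c,d) ↦ (a+d, b−c, a−d, b+c)` of determinant `4` and a measure-preserving regrouping
  `ℝ⁴ ≃ ℂ²`. This is the value `χ₁(1) = 2π²/3` printed in [LovasAndai2017, §5]; it is kept here
  as an internal lemma about the coordinate set (the named fact `LovasAndai2017_chiOne_one` is
  discharged separately).

It also fixes, once and for all, the auxiliary DEFINITIONS used by the two theorem-only sequels
(`LovasAndaiLemma6Fiber.lean`, `LovasAndaiLemma6.lean`): the regrouping `ℝ⁴ ≃ ℝ² × ℝ²`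
`z ↦ ((z₀, z₃), (z₁, z₂))` (diagonal / off-diagonal entries), the hyperbolic chart
`(m, τ) ↦ (√m e^τ, √m e^{-τ})` of the open quadrant of the off-diagonal plane (in which Lovas–Andai's
similarity `V_ε⁻¹ · V_ε`, `ε = e^{-δ}`, is the translation `τ ↦ τ − δ` — the rôle played by the
coordinate `t` of the atlas of [LovasAndai2017, App. A]) with its Jacobian, the norm function
`hypNorm a d m τ = N(a, √m e^τ, √m e^{-τ}, d)` along the chart, the length `mStar a d t` of its
`m`-sections and the resulting density `defectDensity t` (one quarter of the derivative of
Lovas–Andai's defect function `Δ`, [LovasAndai2017, App. A, last display]).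

All declarations of this development live in the sub-namespace
`Literature.Probability.RandomMatrix.LovasAndaiLemma6`.

## References

* [LovasAndai2017] Lovas–Andai 2017, §2 (Lemma 3, Lemma 5, Definition 1, Lemma 6), §5, App. A.
-/

noncomputable section

open MeasureTheory Set
open scoped ENNReal Matrix

namespace Literature.Probability.RandomMatrix.LovasAndaiLemma6

/-! ### `2 × 2` positive definiteness -/

/-- A real symmetric `2 × 2` matrix is positive definite iff its determinant and its trace are
positive (Sylvester's criterion, `2 × 2` case). [folklore] -/
theorem posDef_fin_two_iff (M : Matrix (Fin 2) (Fin 2) ℝ) (hM : M.IsHermitian) :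
    M.PosDef ↔ 0 < M 0 0 * M 1 1 - M 0 1 * M 1 0 ∧ 0 < M 0 0 + M 1 1 := by
  have hsym : M 1 0 = M 0 1 := by
    have := congrFun (congrFun hM 0) 1
    simpa [Matrix.conjTranspose_apply] using this
  have hq : ∀ x : Fin 2 → ℝ, star x ⬝ᵥ M.mulVec x =
      M 0 0 * x 0 ^ 2 + 2 * M 0 1 * x 0 * x 1 + M 1 1 * x 1 ^ 2 := by
    intro x
    simp [Matrix.mulVec, dotProduct, Fin.sum_univ_two, hsym]
    ring
  rw [Matrix.posDef_iff_dotProduct_mulVec]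
  constructor
  · rintro ⟨-, h⟩
    have h1 := h (x := ![1, 0]) (by simp)
    have h2 := h (x := ![0, 1]) (by simp)
    have h3 := h (x := ![-M 0 1, M 0 0]) (by
      intro h0
      have := congrFun h0 1
      simp at this
      rw [hq] at h1
      simp at h1
      linarith)
    rw [hq] at h1 h2 h3
    simp at h1 h2 h3
    rw [hsym]
    constructor
    · nlinarith [h3]
    · linarith
  · rintro ⟨hdet, htr⟩
    refine ⟨hM, fun x hx => ?_⟩
    rw [hq]
    rw [hsym] at hdet
    have ha : 0 < M 0 0 := by nlinarith [sq_nonneg (M 0 1)]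
    by_contra hcon
    push Not at hcon
    have hx1 : x 1 = 0 := by
      by_contra h1
      have : 0 < (M 0 0 * M 1 1 - M 0 1 * M 0 1) * x 1 ^ 2 := by positivity
      nlinarith [sq_nonneg (M 0 0 * x 0 + M 0 1 * x 1)]
    have hx0 : x 0 = 0 := by
      by_contra h0
      have : 0 < (M 0 0 * x 0 + M 0 1 * x 1) ^ 2 := by
        rw [hx1]; simp; positivity
      nlinarith [sq_nonneg (x 1)]
    apply hx
    ext i; fin_cases i <;> simp [hx0, hx1]

/-! ### The coordinate function `N = 2‖X‖_op` -/

/-- `N(a,b,c,d) = √((a+d)² + (b−c)²) + √((a−d)² + (b+c)²)`, twice the operator norm (largest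
singular value) of the real matrix `[[a, b], [c, d]]`. [folklore] -/
def twiceOpNorm (a b c d : ℝ) : ℝ :=
  √((a + d) ^ 2 + (b - c) ^ 2) + √((a - d) ^ 2 + (b + c) ^ 2)

/-- `N ≥ 0`. [folklore] -/
theorem twiceOpNorm_nonneg (a b c d : ℝ) : 0 ≤ twiceOpNorm a b c d := by
  unfold twiceOpNorm; positivity

/-- `N` is symmetric in the two off-diagonal entries. [folklore] -/
theorem twiceOpNorm_swap (a b c d : ℝ) : twiceOpNorm a c b d = twiceOpNorm a b c d := by
  unfold twiceOpNorm
  rw [show (c - b) ^ 2 = (b - c) ^ 2 by ring, add_comm c b]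

/-- `N` is invariant under negating both off-diagonal entries. [folklore] -/
theorem twiceOpNorm_neg_neg (a b c d : ℝ) : twiceOpNorm a (-b) (-c) d = twiceOpNorm a b c d := by
  unfold twiceOpNorm
  rw [show (-b - -c) ^ 2 = (b - c) ^ 2 by ring, show (-b + -c) ^ 2 = (b + c) ^ 2 by ring]

/-- `N` is invariant under `(b, d) ↦ (−b, −d)`. [folklore] -/
theorem twiceOpNorm_negb_negd (a b c d : ℝ) :
    twiceOpNorm a (-b) c (-d) = twiceOpNorm a b c d := by
  unfold twiceOpNorm
  rw [show (a + -d) ^ 2 = (a - d) ^ 2 by ring, show (-b - c) ^ 2 = (b + c) ^ 2 by ring,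
    show (a - -d) ^ 2 = (a + d) ^ 2 by ring, show (-b + c) ^ 2 = (b - c) ^ 2 by ring, add_comm]

/-- `N` is invariant under `(c, d) ↦ (−c, −d)`. [folklore] -/
theorem twiceOpNorm_negc_negd (a b c d : ℝ) :
    twiceOpNorm a b (-c) (-d) = twiceOpNorm a b c d := by
  rw [← twiceOpNorm_neg_neg a b (-c) (-d), neg_neg, twiceOpNorm_negb_negd]

/-- The lower bound `N(a,b,c,d) ≥ |a + d| + |a − d|` (drop the off-diagonal squares). [folklore] -/
theorem abs_add_abs_le_twiceOpNorm (a b c d : ℝ) :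
    |a + d| + |a - d| ≤ twiceOpNorm a b c d := by
  unfold twiceOpNorm
  gcongr
  · calc |a + d| = √((a + d) ^ 2) := (Real.sqrt_sq_eq_abs _).symm
      _ ≤ √((a + d) ^ 2 + (b - c) ^ 2) := Real.sqrt_le_sqrt (by nlinarith [sq_nonneg (b - c)])
  · calc |a - d| = √((a - d) ^ 2) := (Real.sqrt_sq_eq_abs _).symm
      _ ≤ √((a - d) ^ 2 + (b + c) ^ 2) := Real.sqrt_le_sqrt (by nlinarith [sq_nonneg (b + c)])

/-- Continuity of `N` composed with continuous coordinate functions. [folklore] -/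
theorem continuous_twiceOpNorm_comp {X : Type*} [TopologicalSpace X] {f g h k : X → ℝ}
    (hf : Continuous f) (hg : Continuous g) (hh : Continuous h) (hk : Continuous k) :
    Continuous fun x => twiceOpNorm (f x) (g x) (h x) (k x) := by
  unfold twiceOpNorm; fun_prop

/-- Measurability of `N` composed with measurable coordinate functions. [folklore] -/
theorem measurable_twiceOpNorm_comp {X : Type*} [MeasurableSpace X] {f g h k : X → ℝ}
    (hf : Measurable f) (hg : Measurable g) (hh : Measurable h) (hk : Measurable k) :
    Measurable fun x => twiceOpNorm (f x) (g x) (h x) (k x) := by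
  unfold twiceOpNorm; fun_prop

/-- The invariants `det(1 − XᵀX) = 1 − ‖X‖²_HS + det(X)²` and `tr(1 − XᵀX) = 2 − ‖X‖²_HS` of
`X = [[a,b],[c,d]]` are both positive iff `N(a,b,c,d) < 2`; indeed
`det(1 − XᵀX) = (1 − ((N₁+N₂)/2)²)(1 − ((N₁−N₂)/2)²)` and `‖X‖²_HS = (N₁² + N₂²)/2`. [folklore] -/
theorem det_tr_pos_iff (a b c d : ℝ) :
    (0 < 1 - (a ^ 2 + b ^ 2 + c ^ 2 + d ^ 2) + (a * d - b * c) ^ 2 ∧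
      0 < 2 - (a ^ 2 + b ^ 2 + c ^ 2 + d ^ 2)) ↔ twiceOpNorm a b c d < 2 := by
  unfold twiceOpNorm
  set P := (a + d) ^ 2 + (b - c) ^ 2 with hP
  set Q := (a - d) ^ 2 + (b + c) ^ 2 with hQ
  have hP0 : 0 ≤ P := by positivity
  have hQ0 : 0 ≤ Q := by positivity
  set n₁ := √P with hn₁
  set n₂ := √Q with hn₂
  have h1 : n₁ ^ 2 = P := Real.sq_sqrt hP0
  have h2 : n₂ ^ 2 = Q := Real.sq_sqrt hQ0
  have hn₁0 : 0 ≤ n₁ := Real.sqrt_nonneg _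
  have hn₂0 : 0 ≤ n₂ := Real.sqrt_nonneg _
  have hsum : a ^ 2 + b ^ 2 + c ^ 2 + d ^ 2 = (n₁ ^ 2 + n₂ ^ 2) / 2 := by
    rw [h1, h2, hP, hQ]; ring
  have hdet : a * d - b * c = (n₁ ^ 2 - n₂ ^ 2) / 4 := by
    rw [h1, h2, hP, hQ]; ring
  have hfac : 1 - (a ^ 2 + b ^ 2 + c ^ 2 + d ^ 2) + (a * d - b * c) ^ 2
      = (4 - (n₁ + n₂) ^ 2) * (4 - (n₁ - n₂) ^ 2) / 16 := by
    rw [hsum, hdet]; ring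
  rw [hfac, hsum]
  constructor
  · rintro ⟨hd, ht⟩
    by_contra hcon
    push Not at hcon
    have hA : 4 - (n₁ + n₂) ^ 2 ≤ 0 := by nlinarith
    have hB : 4 - (n₁ - n₂) ^ 2 < 0 := by
      by_contra hB
      push Not at hB
      have : (4 - (n₁ + n₂) ^ 2) * (4 - (n₁ - n₂) ^ 2) ≤ 0 :=
        mul_nonpos_of_nonpos_of_nonneg hA hB
      linarith
    nlinarith
  · intro h
    have hA : 0 < 4 - (n₁ + n₂) ^ 2 := by nlinarith
    have hB : 0 < 4 - (n₁ - n₂) ^ 2 := by nlinarith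
    constructor
    · positivity
    · nlinarith

/-- **Lovas–Andai's Lemma 3 in coordinates.** For `X = [[a, b], [c, d]]`:
`1 − XᵀX ≻ 0 ⟺ N(a,b,c,d) < 2` (i.e. `‖X‖_op < 1`). [cite: LovasAndai2017, Lemma 3] -/
theorem posDef_one_sub_iff (a b c d : ℝ) :
    (1 - (!![a, b; c, d])ᵀ * !![a, b; c, d]).PosDef ↔ twiceOpNorm a b c d < 2 := by
  have hH : (1 - (!![a, b; c, d])ᵀ * !![a, b; c, d]).IsHermitian := by
    have h := Matrix.isHermitian_conjTranspose_mul_self (!![a, b; c, d] : Matrix (Fin 2) (Fin 2) ℝ)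
    rw [Matrix.conjTranspose_eq_transpose_of_trivial] at h
    exact Matrix.isHermitian_one.sub h
  rw [posDef_fin_two_iff _ hH, ← det_tr_pos_iff]
  simp [Matrix.mul_apply, Fin.sum_univ_two]
  constructor
  · rintro ⟨h1, h2⟩; constructor <;> nlinarith [h1, h2]
  · rintro ⟨h1, h2⟩; constructor <;> nlinarith [h1, h2]

/-! ### Lovas–Andai's `χ₁` as the volume of a coordinate set -/

/-- The integrand set of `χ₁(ε)` in coordinates: `N(z) < 2 ∧ N(V_ε⁻¹ z V_ε) < 2`.
[cite: LovasAndai2017, Definition 1] -/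
def normSet (ε : ℝ) : Set (Fin 4 → ℝ) :=
  {z | twiceOpNorm (z 0) (z 1) (z 2) (z 3) < 2 ∧ twiceOpNorm (z 0) (ε * z 1) (z 2 / ε) (z 3) < 2}

/-- `χ₁(ε) = vol(normSet ε)`. [cite: LovasAndai2017, Definition 1 and Lemma 3] -/
theorem lovasAndaiChiOne_eq_volume_normSet (ε : ℝ) :
    lovasAndaiChiOne ε = volume (normSet ε) := by
  unfold lovasAndaiChiOne normSet
  congr 1
  ext z
  simp only [mem_setOf_eq]
  rw [show realMatrixTwo z = !![z 0, z 1; z 2, z 3] from rfl,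
    show lovasAndaiConj ε z = !![z 0, ε * z 1; z 2 / ε, z 3] from rfl,
    posDef_one_sub_iff, posDef_one_sub_iff]

/-- `normSet ε` is open. [folklore] -/
theorem isOpen_normSet (ε : ℝ) : IsOpen (normSet ε) := by
  unfold normSet
  have hc : ∀ i : Fin 4, Continuous fun z : Fin 4 → ℝ => z i := fun i => continuous_apply i
  refine IsOpen.inter ?_ ?_
  · exact isOpen_lt (continuous_twiceOpNorm_comp (hc 0) (hc 1) (hc 2) (hc 3)) continuous_const
  · exact isOpen_lt (continuous_twiceOpNorm_comp (hc 0) (continuous_const.mul (hc 1))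
      ((hc 2).div_const ε) (hc 3)) continuous_const

/-- `normSet ε` is measurable. [folklore] -/
theorem measurableSet_normSet (ε : ℝ) : MeasurableSet (normSet ε) :=
  (isOpen_normSet ε).measurableSet

/-- At `ε = 1` the two conditions coincide: `normSet 1 = {N < 2}`. [folklore] -/
theorem normSet_one : normSet 1 = {z : Fin 4 → ℝ | twiceOpNorm (z 0) (z 1) (z 2) (z 3) < 2} := by
  ext z; simp [normSet]

/-! ### The volume of the operator-norm unit ball: `vol{N < 2} = 2π²/3` -/

/-- Measure-preserving regrouping `ℝ⁴ ≃ ℂ²`, `z ↦ (z₀ + z₁ i, z₂ + z₃ i)`. [folklore] -/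
def regroup : (Fin 4 → ℝ) ≃ᵐ (Fin 2 → ℂ) :=
  ((MeasurableEquiv.piCongrLeft (fun _ : Fin 4 => ℝ) (finSumFinEquiv (m := 2) (n := 2))).symm.trans
    (MeasurableEquiv.sumPiEquivProdPi (fun _ : Fin 2 ⊕ Fin 2 => ℝ))).trans
  ((MeasurableEquiv.prodCongr Complex.measurableEquivPi.symm Complex.measurableEquivPi.symm).trans
    (MeasurableEquiv.finTwoArrow (α := ℂ)).symm)

/-- First component of `regroup`. [folklore] -/
theorem regroup_apply_zero (w : Fin 4 → ℝ) : regroup w 0 = ⟨w 0, w 1⟩ := by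
  simp [regroup, MeasurableEquiv.piCongrLeft, Equiv.piCongrLeft, MeasurableEquiv.sumPiEquivProdPi,
    Complex.measurableEquivPi, MeasurableEquiv.finTwoArrow, MeasurableEquiv.prodCongr,
    Complex.ext_iff]
  constructor <;> rfl

/-- Second component of `regroup`. [folklore] -/
theorem regroup_apply_one (w : Fin 4 → ℝ) : regroup w 1 = ⟨w 2, w 3⟩ := by
  simp [regroup, MeasurableEquiv.piCongrLeft, Equiv.piCongrLeft, MeasurableEquiv.sumPiEquivProdPi,
    Complex.measurableEquivPi, MeasurableEquiv.finTwoArrow, MeasurableEquiv.prodCongr,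
    Complex.ext_iff]
  constructor <;> rfl

/-- `regroup` preserves Lebesgue measure. [folklore] -/
theorem measurePreserving_regroup : MeasurePreserving regroup volume volume := by
  unfold regroup
  refine MeasurePreserving.trans (μb := volume) ?_ ?_
  · refine MeasurePreserving.trans (μb := volume) ?_ ?_
    · exact (volume_measurePreserving_piCongrLeft (fun _ : Fin 4 => ℝ)
        (finSumFinEquiv (m := 2) (n := 2))).symm _
    · have := measurePreserving_sumPiEquivProdPi (fun _ : Fin 2 ⊕ Fin 2 => (volume : Measure ℝ))
      simpa [volume_pi, Measure.volume_eq_prod] using this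
  · refine MeasurePreserving.trans (μb := volume) ?_ ?_
    · have h := Complex.volume_preserving_equiv_pi
      have h2 := (h.symm _).prod (h.symm _)
      rw [← Measure.volume_eq_prod, ← Measure.volume_eq_prod] at h2
      exact h2
    · exact (volume_preserving_finTwoArrow ℂ).symm _

/-- Volume of `{√(w₀²+w₁²) + √(w₂²+w₃²) < 2} ⊆ ℝ⁴` is `8π²/3` (`= 2⁴ · π²/6`). [folklore] -/
theorem volume_ball_aux :
    volume {w : Fin 4 → ℝ | √(w 0 ^ 2 + w 1 ^ 2) + √(w 2 ^ 2 + w 3 ^ 2) < 2}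
      = ENNReal.ofReal (8 * Real.pi ^ 2 / 3) := by
  have key := Complex.volume_sum_rpow_lt (Fin 2) (p := 1) le_rfl 2
  have hset : {w : Fin 4 → ℝ | √(w 0 ^ 2 + w 1 ^ 2) + √(w 2 ^ 2 + w 3 ^ 2) < 2}
      = regroup ⁻¹' {x : Fin 2 → ℂ | (∑ i, ‖x i‖ ^ (1:ℝ)) ^ (1 / (1:ℝ)) < 2} := by
    ext w
    simp [Fin.sum_univ_two, regroup_apply_zero, regroup_apply_one, Complex.norm_def,
      Complex.normSq_apply, sq]
  rw [hset, measurePreserving_regroup.measure_preimage_equiv, key]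
  have h3 : Real.Gamma (2 / 1 + 1) = 2 := by
    have := Real.Gamma_nat_eq_factorial 2
    norm_num at this ⊢
  have h5 : Real.Gamma (2 * (2:ℕ) / 1 + 1) = 24 := by
    have := Real.Gamma_nat_eq_factorial 4
    norm_num [Nat.factorial] at this ⊢
  simp only [Fintype.card_fin, h3, h5]
  rw [← ENNReal.ofReal_pow (by norm_num), ← ENNReal.ofReal_mul (by norm_num)]
  congr 1
  ring

/-- The matrix of the linear coordinate change `(a,b,c,d) ↦ (a+d, b−c, a−d, b+c)`. [folklore] -/
def tMat : Matrix (Fin 4) (Fin 4) ℝ := !![1, 0, 0, 1; 0, 1, -1, 0; 1, 0, 0, -1; 0, 1, 1, 0]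

/-- `det tMat = 4`. [folklore] -/
theorem det_tMat : tMat.det = 4 := by
  simp [tMat, Matrix.det_succ_row_zero, Fin.sum_univ_succ, Matrix.submatrix, Fin.succAbove]
  norm_num

/-- `tMat` acts as `(a,b,c,d) ↦ (a+d, b−c, a−d, b+c)`. [folklore] -/
theorem toLin'_tMat (z : Fin 4 → ℝ) :
    Matrix.toLin' tMat z = ![z 0 + z 3, z 1 - z 2, z 0 - z 3, z 1 + z 2] := by
  ext i
  fin_cases i <;> simp [tMat, Matrix.mulVec, dotProduct, Fin.sum_univ_four] <;> ring

/-- **`vol{X ∈ ℝ^{2×2} : ‖X‖_op < 1} = 2π²/3`** in coordinates: the Lebesgue measure of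
`{z : ℝ⁴ | N(z) < 2}`. This is the value `χ₁(1) = (2/3)π²` of [LovasAndai2017, §5 (real case)].
[cite: LovasAndai2017, §5] -/
theorem volume_normBall :
    volume {z : Fin 4 → ℝ | twiceOpNorm (z 0) (z 1) (z 2) (z 3) < 2}
      = ENNReal.ofReal (2 / 3 * Real.pi ^ 2) := by
  have hset : {z : Fin 4 → ℝ | twiceOpNorm (z 0) (z 1) (z 2) (z 3) < 2}
      = (Matrix.toLin' tMat) ⁻¹'
          {w : Fin 4 → ℝ | √(w 0 ^ 2 + w 1 ^ 2) + √(w 2 ^ 2 + w 3 ^ 2) < 2} := by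
    ext z
    simp only [mem_setOf_eq, mem_preimage, toLin'_tMat]
    simp [twiceOpNorm]
  have hdet : LinearMap.det (Matrix.toLin' tMat) ≠ 0 := by
    rw [LinearMap.det_toLin', det_tMat]; norm_num
  rw [hset, Measure.addHaar_preimage_linearMap _ hdet, volume_ball_aux, LinearMap.det_toLin',
    det_tMat, ← ENNReal.ofReal_mul (by norm_num)]
  congr 1
  rw [abs_of_pos (by norm_num)]
  ring

/-- Hence `χ₁(1) = 2π²/3` for the coordinate rendering `lovasAndaiChiOne`.
[cite: LovasAndai2017, §5] -/
theorem lovasAndaiChiOne_one : lovasAndaiChiOne 1 = ENNReal.ofReal (2 / 3 * Real.pi ^ 2) := by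
  rw [lovasAndaiChiOne_eq_volume_normSet, normSet_one, volume_normBall]


/-! ### Regrouping `ℝ⁴ ≃ ℝ² × ℝ²` into diagonal and off-diagonal entries -/

/-- Index regrouping `Fin 2 ⊕ Fin 2 ≃ Fin 4`: `inl 0 ↦ 0, inl 1 ↦ 3, inr 0 ↦ 1, inr 1 ↦ 2`.
[folklore] -/
def idx4 : Fin 2 ⊕ Fin 2 ≃ Fin 4 where
  toFun := Sum.elim ![0, 3] ![1, 2]
  invFun := ![Sum.inl 0, Sum.inr 0, Sum.inr 1, Sum.inl 1]
  left_inv := by intro x; rcases x with x | x <;> fin_cases x <;> rfl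
  right_inv := by intro x; fin_cases x <;> rfl

/-- The measurable equivalence `z ↦ ((z 0, z 3), (z 1, z 2))` (diagonal entries `(a, d)`,
off-diagonal entries `(b, c)` of `[[z0, z1], [z2, z3]]`). [folklore] -/
def regroup₂ : (Fin 4 → ℝ) ≃ᵐ (ℝ × ℝ) × (ℝ × ℝ) :=
  ((MeasurableEquiv.piCongrLeft (fun _ : Fin 4 => ℝ) idx4).symm.trans
    (MeasurableEquiv.sumPiEquivProdPi (fun _ : Fin 2 ⊕ Fin 2 => ℝ))).trans
  (MeasurableEquiv.prodCongr (MeasurableEquiv.finTwoArrow (α := ℝ))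
    (MeasurableEquiv.finTwoArrow (α := ℝ)))

/-- `regroup₂ z = ((z 0, z 3), (z 1, z 2))`. [folklore] -/
theorem regroup₂_apply (z : Fin 4 → ℝ) : regroup₂ z = ((z 0, z 3), (z 1, z 2)) := by
  simp [regroup₂, MeasurableEquiv.piCongrLeft, Equiv.piCongrLeft, MeasurableEquiv.sumPiEquivProdPi,
    MeasurableEquiv.finTwoArrow, MeasurableEquiv.prodCongr, idx4]

/-- `regroup₂` preserves Lebesgue measure. [folklore] -/
theorem measurePreserving_regroup₂ : MeasurePreserving regroup₂ volume volume := by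
  unfold regroup₂
  refine MeasurePreserving.trans (μb := volume) ?_ ?_
  · refine MeasurePreserving.trans (μb := volume) ?_ ?_
    · exact (volume_measurePreserving_piCongrLeft (fun _ : Fin 4 => ℝ) idx4).symm _
    · have := measurePreserving_sumPiEquivProdPi (fun _ : Fin 2 ⊕ Fin 2 => (volume : Measure ℝ))
      simpa [volume_pi, Measure.volume_eq_prod] using this
  · have h := volume_preserving_finTwoArrow ℝ
    have h2 := h.prod h
    rw [← Measure.volume_eq_prod, ← Measure.volume_eq_prod] at h2
    exact h2

/-! ### The hyperbolic chart of the open quadrant -/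

/-- The hyperbolic chart `(m, τ) ↦ (√m e^τ, √m e^{-τ})` of the open quadrant `{b > 0, c > 0}`
(`m = bc`, `τ = log(b/c)/2`); Lovas–Andai's similarity `(b, c) ↦ (ε b, c/ε)`, `ε = e^{-δ}`, becomes
the translation `τ ↦ τ − δ`. [cite: LovasAndai2017, App. A (the coordinate `t`)] -/
def hypChart (x : ℝ × ℝ) : ℝ × ℝ := (√x.1 * Real.exp x.2, √x.1 * Real.exp (-x.2))

/-- The derivative of `hypChart` at `x` (for `x.1 > 0`), of determinant `-1`. [folklore] -/
def fderivHypChart (x : ℝ × ℝ) : ℝ × ℝ →L[ℝ] ℝ × ℝ :=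
  (Matrix.toLin (.finTwoProd ℝ) (.finTwoProd ℝ)
    !![Real.exp x.2 / (2 * √x.1), √x.1 * Real.exp x.2;
       Real.exp (-x.2) / (2 * √x.1), -(√x.1 * Real.exp (-x.2))]).toContinuousLinearMap

/-- `hypChart` has derivative `fderivHypChart x` at every `x` with `x.1 > 0`. [folklore] -/
theorem hasFDerivAt_hypChart (x : ℝ × ℝ) (hx : 0 < x.1) :
    HasFDerivAt hypChart (fderivHypChart x) x := by
  unfold fderivHypChart
  rw [Matrix.toLin_finTwoProd_toContinuousLinearMap]
  have h1 := (Real.hasDerivAt_sqrt hx.ne').comp_hasFDerivAt x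
    (hasFDerivAt_fst (𝕜 := ℝ) (p := x))
  have h2 := (Real.hasDerivAt_exp x.2).comp_hasFDerivAt x (hasFDerivAt_snd (𝕜 := ℝ) (p := x))
  have h3 := ((Real.hasDerivAt_exp (-x.2)).comp x.2 (hasDerivAt_neg x.2)).comp_hasFDerivAt x
    (hasFDerivAt_snd (𝕜 := ℝ) (p := x))
  convert! HasFDerivAt.prodMk (𝕜 := ℝ) (h1.mul h2) (h1.mul h3) using 2 <;>
  simp [smul_smul, add_comm, smul_neg, neg_smul _ (ContinuousLinearMap.snd ℝ ℝ ℝ)]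
  · rw [add_comm]; congr 2; ring
  · congr 2; ring

/-- `det (fderivHypChart x) = -1` for `x.1 > 0`. [folklore] -/
theorem det_fderivHypChart (x : ℝ × ℝ) (hx : 0 < x.1) : (fderivHypChart x).det = -1 := by
  unfold fderivHypChart
  simp only [LinearMap.det_toContinuousLinearMap, LinearMap.det_toLin, Matrix.det_fin_two_of]
  have hs : √x.1 ≠ 0 := (Real.sqrt_pos.mpr hx).ne'
  have he : Real.exp x.2 * Real.exp (-x.2) = 1 := by rw [← Real.exp_add]; simp
  field_simp
  linear_combination (-2) * he

/-- `hypChart` is injective on `{x.1 > 0}`. [folklore] -/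
theorem hypChart_injOn : InjOn hypChart {x : ℝ × ℝ | 0 < x.1} := by
  rintro ⟨m, τ⟩ hm ⟨m', τ'⟩ hm' h
  simp only [mem_setOf_eq] at hm hm'
  simp only [hypChart, Prod.mk.injEq] at h
  obtain ⟨h1, h2⟩ := h
  have hmm : m = m' := by
    have e1 : (√m * Real.exp τ) * (√m * Real.exp (-τ)) = m := by
      rw [mul_mul_mul_comm, ← Real.exp_add, Real.mul_self_sqrt hm.le]; simp
    have e2 : (√m' * Real.exp τ') * (√m' * Real.exp (-τ')) = m' := by
      rw [mul_mul_mul_comm, ← Real.exp_add, Real.mul_self_sqrt hm'.le]; simp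
    rw [← e1, ← e2, h1, h2]
  subst hmm
  have hs : 0 < √m := Real.sqrt_pos.mpr hm
  have : Real.exp τ = Real.exp τ' := by
    have := h1; field_simp at this; exact this
  rw [Real.exp_eq_exp] at this
  rw [this]

/-- `hypChart` is measurable (indeed continuous). [folklore] -/
theorem measurable_hypChart : Measurable hypChart := by
  unfold hypChart; fun_prop

/-- `hypChart` maps `{x.1 > 0} ∩ hypChart⁻¹ A` onto `A ∩ {b > 0, c > 0}`. [folklore] -/
theorem image_hypChart (A : Set (ℝ × ℝ)) :
    hypChart '' {x | 0 < x.1 ∧ hypChart x ∈ A} = A ∩ {y | 0 < y.1 ∧ 0 < y.2} := by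
  ext ⟨b, c⟩
  constructor
  · rintro ⟨⟨m, τ⟩, ⟨hm, hA⟩, he⟩
    rw [← he]
    dsimp only at hm
    refine ⟨hA, ?_, ?_⟩ <;> simp only [hypChart] <;> positivity
  · rintro ⟨hA, hb, hc⟩
    dsimp only at hb hc
    have hb' : 0 < √b := Real.sqrt_pos.mpr hb
    have hc' : 0 < √c := Real.sqrt_pos.mpr hc
    have key : hypChart (b * c, Real.log (√b / √c)) = (b, c) := by
      simp only [hypChart]
      rw [Real.exp_neg, Real.exp_log (by positivity), Real.sqrt_mul hb.le, Prod.mk.injEq]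
      constructor
      · field_simp; rw [Real.sq_sqrt hb.le]
      · field_simp; rw [Real.sq_sqrt hc.le]
    exact ⟨(b * c, Real.log (√b / √c)), ⟨by simp only; positivity, by rw [key]; exact hA⟩, key⟩

/-- **Change of variables to the hyperbolic chart**: for measurable `A ⊆ ℝ²`,
`vol(A ∩ {b > 0, c > 0}) = vol{(m, τ) : m > 0, hypChart (m, τ) ∈ A}` (the Jacobian is `1`;
compare `√(det g) = r³` for the four-dimensional atlas of [LovasAndai2017, App. A]). [folklore] -/
theorem volume_inter_quadrant (A : Set (ℝ × ℝ)) (hA : MeasurableSet A) :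
    volume (A ∩ {y | 0 < y.1 ∧ 0 < y.2}) = volume {x : ℝ × ℝ | 0 < x.1 ∧ hypChart x ∈ A} := by
  have hs : MeasurableSet {x : ℝ × ℝ | 0 < x.1 ∧ hypChart x ∈ A} :=
    (measurableSet_lt measurable_const measurable_fst).inter (measurable_hypChart hA)
  rw [← image_hypChart A, ← lintegral_abs_det_fderiv_eq_addHaar_image volume hs
    (fun x hx => (hasFDerivAt_hypChart x hx.1).hasFDerivWithinAt)
    (hypChart_injOn.mono fun x hx => hx.1)]
  rw [← setLIntegral_one]
  refine setLIntegral_congr_fun hs fun x hx => ?_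
  rw [det_fderivHypChart x hx.1]; simp

/-! ### The norm along the chart -/

/-- `hypNorm a d m τ = N(a, √m e^τ, √m e^{-τ}, d)`: the function `N` along the hyperbolic chart of
the off-diagonal quadrant, for fixed diagonal entries `(a, d)`. [folklore] -/
def hypNorm (a d m τ : ℝ) : ℝ := twiceOpNorm a (√m * Real.exp τ) (√m * Real.exp (-τ)) d

/-- Explicit form: `hypNorm a d m τ = √((a+d)² + 4m sinh² τ) + √((a−d)² + 4m cosh² τ)` (`m ≥ 0`).
[folklore] -/
theorem hypNorm_eq (a d : ℝ) {m : ℝ} (hm : 0 ≤ m) (τ : ℝ) :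
    hypNorm a d m τ
      = √((a + d) ^ 2 + 4 * m * Real.sinh τ ^ 2) + √((a - d) ^ 2 + 4 * m * Real.cosh τ ^ 2) := by
  unfold hypNorm twiceOpNorm
  have hs : √m ^ 2 = m := Real.sq_sqrt hm
  have h1 : (√m * Real.exp τ - √m * Real.exp (-τ)) ^ 2 = 4 * m * Real.sinh τ ^ 2 := by
    rw [Real.sinh_eq, show (√m * Real.exp τ - √m * Real.exp (-τ)) ^ 2
      = √m ^ 2 * (Real.exp τ - Real.exp (-τ)) ^ 2 by ring, hs]
    ring
  have h2 : (√m * Real.exp τ + √m * Real.exp (-τ)) ^ 2 = 4 * m * Real.cosh τ ^ 2 := by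
    rw [Real.cosh_eq, show (√m * Real.exp τ + √m * Real.exp (-τ)) ^ 2
      = √m ^ 2 * (Real.exp τ + Real.exp (-τ)) ^ 2 by ring, hs]
    ring
  rw [h1, h2]

/-- Half-angle form: `hypNorm a d m (t/2) = √((a+d)² + 2m(cosh t − 1)) + √((a−d)² + 2m(cosh t + 1))`
(`m ≥ 0`). [folklore] -/
theorem hypNorm_half (a d : ℝ) {m : ℝ} (hm : 0 ≤ m) (t : ℝ) :
    hypNorm a d m (t / 2) = √((a + d) ^ 2 + 2 * m * (Real.cosh t - 1))
      + √((a - d) ^ 2 + 2 * m * (Real.cosh t + 1)) := by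
  rw [hypNorm_eq a d hm]
  have h1 : Real.cosh t = Real.cosh (t / 2) ^ 2 + Real.sinh (t / 2) ^ 2 := by
    rw [← Real.cosh_two_mul]; ring_nf
  have h2 : Real.cosh (t / 2) ^ 2 - Real.sinh (t / 2) ^ 2 = 1 := Real.cosh_sq_sub_sinh_sq _
  congr 2
  · linear_combination (-2 * m) * h1 - 2 * m * h2
  · linear_combination (-2 * m) * h1 + 2 * m * h2

/-- In the chart, Lovas–Andai's similarity `(b, c) ↦ (ε b, c / ε)` with `ε = e^{-δ}` is the shift
`τ ↦ τ − δ`. [cite: LovasAndai2017, App. A] -/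
theorem twiceOpNorm_conj_hypChart (a d m τ δ : ℝ) :
    twiceOpNorm a (Real.exp (-δ) * (√m * Real.exp τ)) (√m * Real.exp (-τ) / Real.exp (-δ)) d
      = hypNorm a d m (τ - δ) := by
  unfold hypNorm
  congr 1
  · rw [show τ - δ = τ + -δ by ring, Real.exp_add]; ring
  · rw [div_eq_mul_inv, ← Real.exp_neg, neg_neg, show -(τ - δ) = -τ + δ by ring, Real.exp_add]
    ring

/-- `hypNorm` is even in `τ`. [folklore] -/
theorem hypNorm_neg (a d m τ : ℝ) : hypNorm a d m (-τ) = hypNorm a d m τ := by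
  unfold hypNorm twiceOpNorm
  rw [neg_neg, show (√m * Real.exp (-τ) - √m * Real.exp τ) ^ 2
      = (√m * Real.exp τ - √m * Real.exp (-τ)) ^ 2 by ring,
    add_comm (√m * Real.exp (-τ)) (√m * Real.exp τ)]

/-- `hypNorm` is monotone in `|τ|` (`m ≥ 0`). [folklore] -/
theorem hypNorm_mono_abs (a d : ℝ) {m : ℝ} (hm : 0 ≤ m) {x y : ℝ} (hxy : |x| ≤ |y|) :
    hypNorm a d m x ≤ hypNorm a d m y := by
  rw [hypNorm_eq a d hm, hypNorm_eq a d hm]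
  have hc : Real.cosh x ≤ Real.cosh y := Real.cosh_le_cosh.mpr hxy
  have hc2 : Real.cosh x ^ 2 ≤ Real.cosh y ^ 2 := by
    have := Real.cosh_pos x
    nlinarith [Real.cosh_pos y]
  have hs2 : Real.sinh x ^ 2 ≤ Real.sinh y ^ 2 := by
    rw [Real.sinh_sq, Real.sinh_sq]; linarith
  gcongr

/-- `hypNorm ≥ |a + d| + |a − d|`. [folklore] -/
theorem abs_add_abs_le_hypNorm (a d m τ : ℝ) : |a + d| + |a - d| ≤ hypNorm a d m τ :=
  abs_add_abs_le_twiceOpNorm _ _ _ _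

/-- Joint continuity of `hypNorm` in `(a, d, m, τ)`. [folklore] -/
theorem continuous_hypNorm :
    Continuous fun p : ℝ × ℝ × ℝ × ℝ => hypNorm p.1 p.2.1 p.2.2.1 p.2.2.2 := by
  unfold hypNorm twiceOpNorm; fun_prop

/-- Continuity of `hypNorm` composed with continuous coordinate functions. [folklore] -/
theorem continuous_hypNorm_comp {X : Type*} [TopologicalSpace X] {f g h k : X → ℝ}
    (hf : Continuous f) (hg : Continuous g) (hh : Continuous h) (hk : Continuous k) :
    Continuous fun x => hypNorm (f x) (g x) (h x) (k x) :=
  continuous_hypNorm.comp (hf.prodMk (hg.prodMk (hh.prodMk hk)))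

/-! ### The `m`-section length and the defect density (closed forms used in the sequel) -/

/-- `m*(a, d, t) = cosh t + ad − √(sinh² t + a² + d² + 2ad·cosh t)`: for `t > 0` and `|a|, |d| < 1`
the `m`-section `{m > 0 : hypNorm a d m (t/2) < 2}` is the interval `(0, m*)` (proved in the
sequel). [folklore] -/
def mStar (a d t : ℝ) : ℝ :=
  Real.cosh t + a * d - √(Real.sinh t ^ 2 + a ^ 2 + d ^ 2 + 2 * a * d * Real.cosh t)

/-- The defect density
`(4/3)·(cosh t − (sinh² t / 2)·log((cosh t + 1)/(cosh t − 1)))`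
`= (4/3)·(cosh t − sinh² t · log((e^t + 1)/(e^t − 1)))`, one quarter of `Δ'(t)` for Lovas–Andai's
defect function `Δ(δ) = Vol(𝓑_ℝ) − χ₁(e^{-δ}) = (16/3)∫₀^δ (cosh t − sinh² t log((e^t+1)/(e^t−1))) dt`.
[cite: LovasAndai2017, App. A (last display)] -/
def defectDensity (t : ℝ) : ℝ :=
  4 / 3 * (Real.cosh t - Real.sinh t ^ 2 / 2 * Real.log ((Real.cosh t + 1) / (Real.cosh t - 1)))

end Literature.Probability.RandomMatrix.LovasAndaiLemma6

end
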